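import Summits.QuantumFields.BalabanUV.Beta.PropagatorWoodburyFibreReduction

/-!
# Beta / GAN24 / MonotoneBlocks — the one-step KKT blocks are ORDER-PRESERVING in the fine form: `H ≤ H′ ⟹ H′⁻¹ ≤ H⁻¹`,
# `pivot(H′) ≤ pivot(H)`, `Δ_eff(H) ≤ Δ_eff(H′)`, `Γ(H′) ≤ Γ(H)` (Anderson–Trapp for the shorted operator, from p3's fibre KKT calculus)
# (gan24-p4, BINDER-OWNERS row G-an2-4 ∕ (CONV-C), ALTERNATIVE DISCHARGE «rate OR monotonicity»; NOT IN PRINT — our proof attempt)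

HONEST FRAMING (page 1 of everything the β sub-cell writes): discharging `BetaPertH` makes Bałaban's UV stability UNCONDITIONAL — a
real constructive-QFT result; it is NOT the continuum limit and NOT the Clay problem.  HONEST DEPENDENCY (cell reorg 2026-08-19, verbatim):
«continuum YM on T⁴ ⇐ BetaPertH ∧ nine spine estimates (0/9 proved); BetaPertH ⇐ (D1) ∧ (D4) ∧ CAP+tail; G-an2-4 gates asym, D1 and NE2/3/4.»
HONEST LABEL: «not in print; our proof attempt; alternative discharge of the G-an2-4 row (rate OR monotonicity)»; 0 wall binders instantiated.

ABSOLUTE RULE (cell charter, verbatim): "No internally-minted statement may enter as a cited fact. Every hypothesis is either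
kernel-proved in this package or a verbatim quotation of a PUBLISHED theorem with page reference. The manuscript(s) under audit are
NOT citable for their own disputed steps — they are the thing under adjudication; programme-internal (2001/route/tribunal) claims
are never citable."  Nothing is cited as a hypothesis.  The principle (the shorted operator ∕ Schur complement is monotone in the form —
W. N. Anderson Jr.–G. E. Trapp, SIAM J. Appl. Math. 28 (1975); Horn–Johnson 7.7.P41) is classical; it is RE-PROVED here for the concrete
blocks of gan24-p3's `PropagatorWoodburyFibre` (`pivot`, `effForm`, `flucCov`) from p3's KKT identities BY NAME (`flucCov_mul_form`,
`form_mul_flucCov`, `flucCov_mul_form_mul_flucCov`, `constraint_mul_flucCov`, `flucCov_conjTranspose`, `pivot_posDef`), by the variational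
inequality `⟨x,g⟩ + ⟨g,x⟩ − ⟨g,Hg⟩ ≤ ⟨x,Γ(H)x⟩` for admissible `g` (completing the square) with equality at `g = Γ(H′)x`.  [folklore] throughout.

## ROLE IN THE MONOTONE ROUTE (`HOME/b2b-balaban-gan24-p4/MONOTONE.md` R6 ∕ V5 ∕ V10).  The route's structural input (MONO-K)₂ is a Loewner
chain of the resolvent slot's fibre matrices.  By p3's COMPOSITION LAW (`decimate_kktBlocks_comp`) the one-step blocks of the `j`-step composite
system are the one-step blocks over the `j`-step EFFECTIVE form `E_j`; for a (1.17)-composing presentation `E_j` INCREASES with `j` (asym1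
`MonotoneScales.formDk_mono`).  THIS FILE is the algebra that turns `E_j ≤ E_{j+1}` into the chain: `Γ(E_{j+1}) ≤ Γ(E_j)` (`flucCov_antitone`),
`Δ_eff(E_j) ≤ Δ_eff(E_{j+1})` (`effForm_monotone`), `pivot` and inverse antitone — so `GAN24/MonotoneLoewner.norm_sub_apply_le_of_steps` applies to
the `Γ` and `Δ_eff` blocks with ONE trace datum each.  The minimiser block `ℋ` is not ordered; its deviation is p3's `minimiser_sub`
(`ℋ(H) − ℋ(H′) = Γ(H)(H′ − H)ℋ(H′)`), a domination statement left to the consumer's norm.  What is NOT here: that the β lane's weak-block-gauge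
KKT system composes like (1.17) (p3's located term) — for it `E_j` is not defined and nothing here applies.
-/

namespace Summit.QuantumFields.BalabanUV.Beta.GAN24.MonotoneBlocks

open Matrix
open Summit.QuantumFields.BalabanUV.Beta.PropagatorWoodburyFibre

variable {𝕜 : Type*} [Field 𝕜] [PartialOrder 𝕜] [StarRing 𝕜] [StarOrderedRing 𝕜]
variable {m n : Type*} [Fintype m] [Fintype n] [DecidableEq m] [DecidableEq n]

/-! ## §1 The variational inequality behind the shorted operator -/

omit [PartialOrder 𝕜] [StarOrderedRing 𝕜] [DecidableEq n] in
/-- moving a matrix across the sesquilinear pairing: `star (M *ᵥ v) ⬝ᵥ w = star v ⬝ᵥ (Mᴴ *ᵥ w)`. [folklore] -/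
theorem star_mulVec_dotProduct (M : Matrix n n 𝕜) (v w : n → 𝕜) : star (M *ᵥ v) ⬝ᵥ w = star v ⬝ᵥ (Mᴴ *ᵥ w) := by
  rw [star_mulVec, ← dotProduct_mulVec]

omit [DecidableEq n] in
/-- **COMPLETING THE SQUARE.**  `H` PSD, `Γ` with `Γᴴ H Γ = Γ`; for vectors `x, g` such that `g` is ADMISSIBLE
(`⟨x, Γᴴ H g⟩ = ⟨x, g⟩` and `⟨g, H Γ x⟩ = ⟨g, x⟩` — automatic for `Γ = H⁻¹`, and for the fluctuation covariance when `Q g = 0`):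
`⟨x, g⟩ + ⟨g, x⟩ − ⟨g, H g⟩ ≤ ⟨x, Γ x⟩`. [folklore] -/
theorem pairing_sub_form_le (H Γ : Matrix n n 𝕜) (hH : H.PosSemidef) (hΓHΓ : Γᴴ * H * Γ = Γ) (x g : n → 𝕜)
    (hadm₁ : star x ⬝ᵥ ((Γᴴ * H) *ᵥ g) = star x ⬝ᵥ g) (hadm₂ : star g ⬝ᵥ ((H * Γ) *ᵥ x) = star g ⬝ᵥ x) :
    star x ⬝ᵥ g + star g ⬝ᵥ x - star g ⬝ᵥ (H *ᵥ g) ≤ star x ⬝ᵥ (Γ *ᵥ x) := by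
  have h0 := hH.dotProduct_mulVec_nonneg (g - Γ *ᵥ x)
  have e : star (g - Γ *ᵥ x) ⬝ᵥ (H *ᵥ (g - Γ *ᵥ x)) =
      star g ⬝ᵥ (H *ᵥ g) - star g ⬝ᵥ x - star x ⬝ᵥ g + star x ⬝ᵥ (Γ *ᵥ x) := by
    have e1 : star g ⬝ᵥ (H *ᵥ (Γ *ᵥ x)) = star g ⬝ᵥ x := by rw [mulVec_mulVec]; exact hadm₂
    have e2 : star (Γ *ᵥ x) ⬝ᵥ (H *ᵥ g) = star x ⬝ᵥ g := by
      rw [star_mulVec_dotProduct, mulVec_mulVec]; exact hadm₁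
    have e3 : star (Γ *ᵥ x) ⬝ᵥ (H *ᵥ (Γ *ᵥ x)) = star x ⬝ᵥ (Γ *ᵥ x) := by
      rw [star_mulVec_dotProduct, mulVec_mulVec, mulVec_mulVec, hΓHΓ]
    rw [star_sub, mulVec_sub, sub_dotProduct, dotProduct_sub, dotProduct_sub, e1, e2, e3]
    abel
  rw [e] at h0
  -- h0 : 0 ≤ ⟨g,Hg⟩ − ⟨g,x⟩ − ⟨x,g⟩ + ⟨x,Γx⟩
  have := sub_nonneg.mp (by
    have : star g ⬝ᵥ (H *ᵥ g) - star g ⬝ᵥ x - star x ⬝ᵥ g + star x ⬝ᵥ (Γ *ᵥ x)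
        = star x ⬝ᵥ (Γ *ᵥ x) - (star x ⬝ᵥ g + star g ⬝ᵥ x - star g ⬝ᵥ (H *ᵥ g)) := by abel
    rw [this] at h0
    exact h0)
  exact this

omit [PartialOrder 𝕜] [StarOrderedRing 𝕜] [DecidableEq n] in
/-- **EQUALITY AT THE MINIMISER**: with `Γᴴ = Γ` and `g := Γ x`, `⟨x, g⟩ + ⟨g, x⟩ − ⟨g, H g⟩ = ⟨x, Γ x⟩` (using `Γᴴ H Γ = Γ`). [folklore] -/
theorem pairing_sub_form_eq (H Γ : Matrix n n 𝕜) (hΓ : Γᴴ = Γ) (hΓHΓ : Γᴴ * H * Γ = Γ) (x : n → 𝕜) :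
    star x ⬝ᵥ (Γ *ᵥ x) + star (Γ *ᵥ x) ⬝ᵥ x - star (Γ *ᵥ x) ⬝ᵥ (H *ᵥ (Γ *ᵥ x)) = star x ⬝ᵥ (Γ *ᵥ x) := by
  have e3 : star (Γ *ᵥ x) ⬝ᵥ (H *ᵥ (Γ *ᵥ x)) = star x ⬝ᵥ (Γ *ᵥ x) := by
    rw [star_mulVec_dotProduct, mulVec_mulVec, mulVec_mulVec, hΓHΓ]
  have e4 : star (Γ *ᵥ x) ⬝ᵥ x = star x ⬝ᵥ (Γ *ᵥ x) := by
    rw [star_mulVec_dotProduct, hΓ]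
  rw [e3, e4]
  abel

omit [DecidableEq n] in
/-- **THE SHORTED-OPERATOR COMPARISON (abstract form).**  `H ≤ H'` (PSD difference), `H` PSD; `Γ` a Hermitian generalized inverse of `H`
(`Γᴴ H Γ = Γ`) for which every vector of the form `Γ' x` is admissible; `Γ'` a Hermitian generalized inverse of `H'` (`Γ'ᴴ H' Γ' = Γ'`).
Then `⟨x, Γ' x⟩ ≤ ⟨x, Γ x⟩` for all `x`. [folklore] -/
theorem form_shorted_le (H H' Γ Γ' : Matrix n n 𝕜) (hH : H.PosSemidef) (hle : (H' - H).PosSemidef)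
    (hΓHΓ : Γᴴ * H * Γ = Γ) (hΓ' : Γ'ᴴ = Γ') (hΓ'HΓ' : Γ'ᴴ * H' * Γ' = Γ')
    (hadm₁ : ∀ x, star x ⬝ᵥ ((Γᴴ * H) *ᵥ (Γ' *ᵥ x)) = star x ⬝ᵥ (Γ' *ᵥ x))
    (hadm₂ : ∀ x, star (Γ' *ᵥ x) ⬝ᵥ ((H * Γ) *ᵥ x) = star (Γ' *ᵥ x) ⬝ᵥ x) (x : n → 𝕜) :
    star x ⬝ᵥ (Γ' *ᵥ x) ≤ star x ⬝ᵥ (Γ *ᵥ x) := by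
  set g := Γ' *ᵥ x with hg
  have h1 := pairing_sub_form_eq H' Γ' hΓ' hΓ'HΓ' x
  have h2 := pairing_sub_form_le H Γ hH hΓHΓ x g (hadm₁ x) (hadm₂ x)
  have h3 : star g ⬝ᵥ (H *ᵥ g) ≤ star g ⬝ᵥ (H' *ᵥ g) := by
    have := hle.dotProduct_mulVec_nonneg g
    rw [sub_mulVec, dotProduct_sub] at this
    exact sub_nonneg.mp this
  rw [← hg] at h1
  calc star x ⬝ᵥ g = star x ⬝ᵥ g + star g ⬝ᵥ x - star g ⬝ᵥ (H' *ᵥ g) := h1.symm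
    _ ≤ star x ⬝ᵥ g + star g ⬝ᵥ x - star g ⬝ᵥ (H *ᵥ g) := by
        have := sub_le_sub_left h3 (star x ⬝ᵥ g + star g ⬝ᵥ x); exact this
    _ ≤ star x ⬝ᵥ (Γ *ᵥ x) := h2

/-! ## §2 The inverse is antitone on positive definite matrices -/

/-- **`0 < H ≤ H'` ⟹ `H'⁻¹ ≤ H⁻¹`** (both PD): `(H⁻¹ − H'⁻¹).PosSemidef`. [folklore] -/
theorem inv_antitone {H H' : Matrix n n 𝕜} (hH : H.PosDef) (hH' : H'.PosDef) (hle : (H' - H).PosSemidef) :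
    (H⁻¹ - H'⁻¹).PosSemidef := by
  have hHu := (isUnit_iff_isUnit_det _).mp hH.isUnit
  have hH'u := (isUnit_iff_isUnit_det _).mp hH'.isUnit
  have hi : (H⁻¹)ᴴ = H⁻¹ := hH.isHermitian.inv
  have hi' : (H'⁻¹)ᴴ = H'⁻¹ := hH'.isHermitian.inv
  refine PosSemidef.of_dotProduct_mulVec_nonneg (hH.isHermitian.inv.sub hH'.isHermitian.inv) fun x => ?_
  rw [sub_mulVec, dotProduct_sub, sub_nonneg]
  refine form_shorted_le H H' H⁻¹ H'⁻¹ hH.posSemidef hle ?_ hi' ?_ (fun y => ?_) (fun y => ?_) x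
  · rw [hi, nonsing_inv_mul _ hHu, Matrix.one_mul]
  · rw [hi', nonsing_inv_mul _ hH'u, Matrix.one_mul]
  · rw [hi, nonsing_inv_mul _ hHu, one_mulVec]
  · rw [mul_nonsing_inv _ hHu, one_mulVec]

/-! ## §3 The KKT blocks over a Loewner-larger fine form: pivot ↓, effective form ↑, fluctuation covariance ↓ -/

omit [DecidableEq m] in
/-- **THE PIVOT IS ANTITONE**: `0 < H ≤ H'` ⟹ `Q H'⁻¹ Qᴴ ≤ Q H⁻¹ Qᴴ`. [folklore] -/
theorem pivot_antitone {H H' : Matrix n n 𝕜} (hH : H.PosDef) (hH' : H'.PosDef) (hle : (H' - H).PosSemidef) (Q : Matrix m n 𝕜) :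
    (pivot H Q - pivot H' Q).PosSemidef := by
  have h := (inv_antitone hH hH' hle).mul_mul_conjTranspose_same Q
  have e : pivot H Q - pivot H' Q = Q * (H⁻¹ - H'⁻¹) * Qᴴ := by
    rw [pivot, pivot, Matrix.mul_sub, Matrix.sub_mul]
  rwa [e]

/-- **THE EFFECTIVE FORM IS MONOTONE**: `0 < H ≤ H'`, constraint rows independent ⟹ `Δ_eff(H) ≤ Δ_eff(H')`. [folklore] -/
theorem effForm_monotone {H H' : Matrix n n 𝕜} (hH : H.PosDef) (hH' : H'.PosDef) (hle : (H' - H).PosSemidef) {Q : Matrix m n 𝕜}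
    (hQ : Function.Injective Q.vecMul) : (effForm H' Q - effForm H Q).PosSemidef := by
  unfold effForm
  exact inv_antitone (pivot_posDef hH' hQ) (pivot_posDef hH hQ) (pivot_antitone hH hH' hle Q)

/-- **THE FLUCTUATION COVARIANCE IS ANTITONE** (Anderson–Trapp for the shorted operator, here from the fibre KKT calculus):
`0 < H ≤ H'`, constraint rows independent ⟹ `Γ(H') ≤ Γ(H)`. [folklore] -/
theorem flucCov_antitone {H H' : Matrix n n 𝕜} (hH : H.PosDef) (hH' : H'.PosDef) (hle : (H' - H).PosSemidef) {Q : Matrix m n 𝕜}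
    (hQ : Function.Injective Q.vecMul) : (flucCov H Q - flucCov H' Q).PosSemidef := by
  have hP := isUnit_pivot_of_posDef hH hQ
  have hP' := isUnit_pivot_of_posDef hH' hQ
  have hΓ : (flucCov H Q)ᴴ = flucCov H Q := flucCov_conjTranspose hH.isHermitian
  have hΓ' : (flucCov H' Q)ᴴ = flucCov H' Q := flucCov_conjTranspose hH'.isHermitian
  refine PosSemidef.of_dotProduct_mulVec_nonneg ?_ fun x => ?_
  · have h1 := (flucCov_posSemidef hH hQ).isHermitian
    have h2 := (flucCov_posSemidef hH' hQ).isHermitian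
    exact h1.sub h2
  rw [sub_mulVec, dotProduct_sub, sub_nonneg]
  refine form_shorted_le H H' (flucCov H Q) (flucCov H' Q) hH.posSemidef hle ?_ hΓ' ?_ (fun y => ?_) (fun y => ?_) x
  · rw [hΓ]; exact flucCov_mul_form_mul_flucCov hH.isUnit hP
  · rw [hΓ']; exact flucCov_mul_form_mul_flucCov hH'.isUnit hP'
  · -- admissibility 1: ⟨y, Γ H (Γ' y)⟩ = ⟨y, Γ' y⟩ since Γ H = 1 − ℋ Q and Q Γ' = 0
    rw [hΓ, flucCov_mul_form hH.isUnit, sub_mulVec, one_mulVec, mulVec_mulVec, Matrix.mul_assoc, constraint_mul_flucCov hP',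
      Matrix.mul_zero, zero_mulVec, sub_zero]
  · -- admissibility 2: ⟨Γ' y, H Γ y⟩ = ⟨Γ' y, y⟩ since H Γ = 1 − Qᴴ 𝒞 and Q Γ' = 0
    rw [form_mul_flucCov hH.isUnit, sub_mulVec, one_mulVec, dotProduct_sub, sub_eq_self, star_mulVec_dotProduct, mulVec_mulVec,
      ← Matrix.mul_assoc, ← conjTranspose_mul, constraint_mul_flucCov hP', conjTranspose_zero, Matrix.zero_mul, zero_mulVec,
      dotProduct_zero]

end Summit.QuantumFields.BalabanUV.Beta.GAN24.MonotoneBlocks
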